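import Summits.QuantumFields.YangMills.Theorems.SpecificationCompactnessReversePushforward
import Summits.QuantumFields.YangMills.Theorems.SpecificationCompactnessAveragingPrivateLinks

/-!
# Reverse absolute continuity of Bałaban's (0.4) block-averaging push-forward (every small-loop average, every torus in range)

Lattice half of STUB D (`stub_unitDensityPosAE`) of crux `SpecificationLimitAE` (stmt-QuantumFields-22688, route
`SpecificationCompactness`, LINE 15 «cocycle_limit», planner ym-idea-5 g10).  For the total block averaging `Ū = avgFun ℰ` of
[Balaban1987RG1] (0.4) (tree `BlockAveraging.avgFun`, ANY small-loop average `ℰ`, any regular gauge group with a two-sided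
invariant Haar datum) on a torus in the standing range `j + 1 ≤ m + K` with `d ≥ 2`:

  `fieldMeasure P (j+1) G ≤ (haar {g | ℰ.δ ≤ dist1 g} ^ |bonds|)⁻¹ • (fieldMeasure P j G).map (avgFun ℰ)`

(`fieldMeasure_le_smul_map_avgFun`), hence product Haar on the coarse torus is absolutely continuous with respect to the
push-forward of `ρ·(product Haar)` for every a.e. non-vanishing density `ρ` (`fieldMeasure_absolutelyContinuous_map_avgFun_withDensity`)
— the REVERSE of the tree's `HaarAC`.  MECHANISM (the abstract `ReversePushforward.pi_le_smul_map_of_eq_on`): at every coarse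
bond `c` (direction `μ`) choose the off-central loop index with unit transverse offset `e_{τμ}` (`τμ ≠ μ`) and trivial orderings;
its open holonomy is `U⟨c₋,τμ⟩ · U(ℓ c) · (rest)` with the PRIVATE fine bond `ℓ c = ⟨c₋ + e_{τμ}, μ⟩` (first bond of the
transported segment), which occurs in no other chosen loop, on no axis line and is no central crossing bond (the companion file
`SpecificationCompactnessAveragingPrivateLinks`); off the small-field guard `Ū(c) = U(c)`
(`avgFun_of_not_small`), and the guard at `c` fails as soon as the chosen loop variable has `dist1 ≥ δ`.

Nothing here concerns Bałaban's estimates, the continuum limit or the mass gap; [folklore] lattice combinatorics and measure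
theory about the published formula (0.4).  Width seat ym-line-sfw-p2-w2 g21 (cell ym-idea-1, free hands).
-/

set_option autoImplicit false

noncomputable section

open MeasureTheory Function
open Literature.MathematicalPhysics.QuantumFieldTheory.Balaban1983to89
open Literature.MathematicalPhysics.QuantumFieldTheory.Balaban1983to89.T4Continuum
open Literature.MathematicalPhysics.QuantumFieldTheory.Balaban1983to89.AveragingRT
open Literature.MathematicalPhysics.QuantumFieldTheory.Balaban1983to89.BlockAveraging
open Literature.MathematicalPhysics.QuantumFieldTheory.Balaban1983to89.BlockAveragingHaarAC
open Literature.MathematicalPhysics.QuantumFieldTheory.Balaban1983to89.T4ReflectionCone (holAt_congr netDisp_replicate)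
open Summit.QuantumFields.YangMills.Theorems.AveragingPrivateLinks

namespace Summit.QuantumFields.YangMills.Theorems.AveragingReverseAC

/-! ## §3 Agreement off the two private families -/

section Agree

variable {P : Params} {j : ℕ} {G : Type*} [GaugeGroup G]

/-- If two configurations agree off the central crossing bonds and the private links, their `pre` transports agree.
[folklore] -/
theorem pre_eq_of_agree (hj : j + 1 ≤ P.m + P.K) (τ : Fin P.d → Fin P.d) (hτ : ∀ μ, τ μ ≠ μ) {X U : GaugeField P j G}
    (hXU : ∀ b : PBond P j, (∀ c' : PBond P (j+1), b ≠ centralBond c') → (∀ c' : PBond P (j+1), b ≠ ⟨(emb c'.src).shift (τ c'.dir), c'.dir⟩) → X b = U b)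
    (c : PBond P (j+1)) : pre X c = pre U c :=
  holAt_congr fun _ hs => hXU _ (fun c' => (preLine_ne hj τ hτ c hs c').1) (fun c' => (preLine_ne hj τ hτ c hs c').2)

/-- Same for `post`. [folklore] -/
theorem post_eq_of_agree (hj : j + 1 ≤ P.m + P.K) (τ : Fin P.d → Fin P.d) (hτ : ∀ μ, τ μ ≠ μ) {X U : GaugeField P j G}
    (hXU : ∀ b : PBond P j, (∀ c' : PBond P (j+1), b ≠ centralBond c') → (∀ c' : PBond P (j+1), b ≠ ⟨(emb c'.src).shift (τ c'.dir), c'.dir⟩) → X b = U b)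
    (c : PBond P (j+1)) : post X c = post U c :=
  holAt_congr fun _ hs => hXU _ (fun c' => (postLine_ne hj τ hτ c hs c').1) (fun c' => (postLine_ne hj τ hτ c hs c').2)

omit [GaugeGroup G] in
/-- Same for the transverse first step of the chosen loop. [folklore] -/
theorem first_eq_of_agree (hj : j + 1 ≤ P.m + P.K) (τ : Fin P.d → Fin P.d) {X U : GaugeField P j G}
    (hXU : ∀ b : PBond P j, (∀ c' : PBond P (j+1), b ≠ centralBond c') → (∀ c' : PBond P (j+1), b ≠ ⟨(emb c'.src).shift (τ c'.dir), c'.dir⟩) → X b = U b)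
    (c : PBond P (j+1)) : X ⟨emb c.src, τ c.dir⟩ = U ⟨emb c.src, τ c.dir⟩ :=
  hXU _ (fun c' => centre_ne_centralBond hj c.src _ c') (fun c' => centre_ne_link hj τ c.src _ c')

/-- Same for the rest of the chosen loop (remaining segment bonds and the returning bond). [folklore] -/
theorem rest_eq_of_agree (hj : j + 1 ≤ P.m + P.K) (τ : Fin P.d → Fin P.d) (hτ : ∀ μ, τ μ ≠ μ) {X U : GaugeField P j G}
    (hXU : ∀ b : PBond P j, (∀ c' : PBond P (j+1), b ≠ centralBond c') → (∀ c' : PBond P (j+1), b ≠ ⟨(emb c'.src).shift (τ c'.dir), c'.dir⟩) → X b = U b)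
    (c : PBond P (j+1)) :
    holAt X (walk (((emb c.src).shift (τ c.dir)).shift c.dir) (List.replicate (P.L - 1) (c.dir, true) ++ [(τ c.dir, false)])) =
      holAt U (walk (((emb c.src).shift (τ c.dir)).shift c.dir) (List.replicate (P.L - 1) (c.dir, true) ++ [(τ c.dir, false)])) := by
  rw [walk_append]
  refine holAt_congr fun s hs => ?_
  rw [List.mem_append] at hs
  rcases hs with hs | hs
  · exact hXU _ (fun c' => (segment_ne hj τ c.src (hτ c.dir) rfl hs c').1)
      (fun c' => (segment_ne hj τ c.src (hτ c.dir) rfl hs c').2)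
  · exact hXU _ (fun c' => (return_ne hj τ c.src (hτ c.dir) hs c').1)
      (fun c' => (return_ne hj τ c.src (hτ c.dir) hs c').2)

omit [GaugeGroup G] in
/-- **The doubly resampled configuration** `X = extend ℓ u (extend β g U)` agrees with `U` off the two private families,
takes the value `g c` at `β c` and `u c` at `ℓ c`. [folklore] -/
theorem extend_props (hj : j + 1 ≤ P.m + P.K) (τ : Fin P.d → Fin P.d) (hτ : ∀ μ, τ μ ≠ μ) (U : GaugeField P j G)
    (g u : PBond P (j+1) → G) :
    (∀ b : PBond P j, (∀ c' : PBond P (j+1), b ≠ centralBond c') → (∀ c' : PBond P (j+1), b ≠ ⟨(emb c'.src).shift (τ c'.dir), c'.dir⟩) →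
      extend (fun c : PBond P (j+1) => (⟨(emb c.src).shift (τ c.dir), c.dir⟩ : PBond P j)) u (extend centralBond g U) b = U b) ∧
    (∀ c, extend (fun c : PBond P (j+1) => (⟨(emb c.src).shift (τ c.dir), c.dir⟩ : PBond P j)) u (extend centralBond g U)
      (centralBond c) = g c) ∧
    (∀ c, extend (fun c : PBond P (j+1) => (⟨(emb c.src).shift (τ c.dir), c.dir⟩ : PBond P j)) u (extend centralBond g U)
      ⟨(emb c.src).shift (τ c.dir), c.dir⟩ = u c) := by
  refine ⟨fun b hb1 hb2 => ?_, fun c => ?_, fun c => ?_⟩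
  · rw [extend_apply' _ _ _ (fun ⟨c', hc'⟩ => hb2 c' hc'.symm), extend_apply' _ _ _ (fun ⟨c', hc'⟩ => hb1 c' hc'.symm)]
  · rw [extend_apply' _ _ _ (fun ⟨c', hc'⟩ => link_ne_centralBond hj τ hτ c' c hc'), (centralBond_injective hj).extend_apply]
  · exact (link_injective hj τ).extend_apply _ _ _

end Agree

/-! ## §4 Reverse domination and reverse absolute continuity -/

section Reverse

variable {P : Params} {j : ℕ} {G : Type*} [GaugeGroup G] [MeasurableSpace G] [HaarData G] [RegularGaugeGroup G]

/-- A fixed-point-free self-map of the directions (`d ≥ 2`). [folklore] -/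
theorem exists_transverse (hd : 2 ≤ P.d) : ∃ τ : Fin P.d → Fin P.d, ∀ μ, τ μ ≠ μ := by
  refine ⟨fun μ => if μ.val = 0 then ⟨1, by omega⟩ else ⟨0, by omega⟩, fun μ => ?_⟩
  dsimp only
  split_ifs with h
  · rw [ne_eq, Fin.ext_iff]; dsimp only; omega
  · rw [ne_eq, Fin.ext_iff]; dsimp only; omega

/-- Offsets realising the unit transverse shift `e_ν` inside the block (`L ≥ 3`). [folklore] -/
theorem exists_off_unit (ν : Fin P.d) : ∃ r : Fin P.d → Fin P.L, ∀ κ, off r κ = if κ = ν then 1 else 0 := by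
  have hL := two_mul_half_add_one P
  have hL1 := P.hL.2
  refine ⟨fun κ => if κ = ν then ⟨(P.L - 1) / 2 + 1, by omega⟩ else ⟨(P.L - 1) / 2, by omega⟩, fun κ => ?_⟩
  by_cases h : κ = ν
  · simp only [off, h, if_true]; push_cast; ring
  · simp only [off, h, if_false]; push_cast; ring

omit [RegularGaugeGroup G] in
/-- The Haar datum is a two-sided invariant probability measure (Mathlib instances). [folklore] -/
theorem haar_instances :
    IsProbabilityMeasure (HaarData.haar : Measure G) ∧ (HaarData.haar : Measure G).IsMulLeftInvariant ∧
      (HaarData.haar : Measure G).IsMulRightInvariant :=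
  ⟨HaarData.isProb, ⟨fun g => HaarData.map_mul_left g⟩, ⟨fun g => HaarData.map_mul_right g⟩⟩

/-- **REVERSE DOMINATION FOR BAŁABAN'S BLOCK AVERAGING (0.4)** (standing range, `d ≥ 2`, any small-loop average `ℰ` with a
measurable inner operation): `fieldMeasure P (j+1) G ≤ (haar {g | ℰ.δ ≤ dist1 g} ^ |PBond P (j+1)|)⁻¹ • (fieldMeasure P j G).map Ū`.
[folklore] -/
theorem fieldMeasure_le_smul_map_avgFun (hj : j + 1 ≤ P.m + P.K) (hd : 2 ≤ P.d) (ℰ : LoopAverage G)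
    (hE : ∀ n, Measurable (fun W : Fin (n+1) → G => ℰ.E W)) (hR0 : (HaarData.haar : Measure G) {g | ℰ.δ ≤ dist1 g} ≠ 0) :
    fieldMeasure P (j+1) G ≤
      ((HaarData.haar : Measure G) {g | ℰ.δ ≤ dist1 g} ^ Fintype.card (PBond P (j+1)))⁻¹ •
        (fieldMeasure P j G).map (avgFun ℰ) := by
  classical
  obtain ⟨hprob, hleft, hright⟩ := haar_instances (G := G)
  obtain ⟨τ, hτ⟩ := exists_transverse (P := P) hd
  choose r hr using fun μ : Fin P.d => exists_off_unit (P := P) (τ μ)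
  unfold fieldMeasure
  refine ReversePushforward.pi_le_smul_map_of_eq_on (HaarData.haar : Measure G) (centralBond_injective hj)
    (link_injective hj τ) (fun U c => axialAvg U c) (fun U c => openHol U c (r c.dir, 1, 1))
    measurable_axialAvg (measurable_pi_lambda _ fun c => ?_)
    (fun U c => pre U c) (fun U c => post U c) (fun U c => U ⟨emb c.src, τ c.dir⟩)
    (fun U c => holAt U (walk (((emb c.src).shift (τ c.dir)).shift c.dir)
      (List.replicate (P.L - 1) (c.dir, true) ++ [(τ c.dir, false)])))
    (fun U g u c => ?_) (fun U g u c => ?_) (avgFun ℰ) (measurable_avgFun ℰ hE)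
    (measurableSet_le measurable_const RegularGaugeGroup.measurable_dist1) hR0 (fun U hU => ?_)
  · -- measurability of the chosen open holonomy
    exact measurable_holAt _
  · -- `A = pre · g · post` after resampling
    obtain ⟨hXU, hβ, -⟩ := extend_props hj τ hτ U g u
    rw [axialAvg_eq_pre_mul_mul_post, pre_eq_of_agree hj τ hτ hXU, post_eq_of_agree hj τ hτ hXU, hβ]
  · -- `V = p · u · s` after resampling
    obtain ⟨hXU, -, hℓ⟩ := extend_props hj τ hτ U g u
    rw [openHol_unit _ c (r c.dir) (τ c.dir) (hr c.dir), first_eq_of_agree hj τ hXU, hℓ,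
      rest_eq_of_agree hj τ hτ hXU, mul_assoc]
  · -- off the guard the block averaging is the axial one
    funext c
    refine avgFun_of_not_small ℰ U c fun hS => ?_
    have h := hS (r c.dir, 1, 1)
    rw [loopHol_eq_openHol_mul] at h
    exact not_lt.mpr (hU c) h

/-- **REVERSE ABSOLUTE CONTINUITY WITH A DENSITY**: for every a.e. non-vanishing density `ρ` of the fine configurations, product
Haar on the coarse torus is absolutely continuous with respect to the push-forward of `ρ · (product Haar)` under Bałaban's block
averaging — the reverse of the tree's `HaarAC`. [folklore] -/
theorem fieldMeasure_absolutelyContinuous_map_avgFun_withDensity (hj : j + 1 ≤ P.m + P.K) (hd : 2 ≤ P.d)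
    (ℰ : LoopAverage G) (hE : ∀ n, Measurable (fun W : Fin (n+1) → G => ℰ.E W))
    (hR0 : (HaarData.haar : Measure G) {g | ℰ.δ ≤ dist1 g} ≠ 0)
    {ρ : GaugeField P j G → ENNReal} (hρ : AEMeasurable ρ (fieldMeasure P j G)) (hρ0 : ∀ᵐ U ∂(fieldMeasure P j G), ρ U ≠ 0) :
    fieldMeasure P (j+1) G ≪ ((fieldMeasure P j G).withDensity ρ).map (avgFun ℰ) :=
  (Measure.absolutelyContinuous_of_le_smul (fieldMeasure_le_smul_map_avgFun hj hd ℰ hE hR0)).trans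
    ((withDensity_absolutelyContinuous' hρ hρ0).map (measurable_avgFun ℰ hE))

end Reverse

end Summit.QuantumFields.YangMills.Theorems.AveragingReverseAC

end
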